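import Mathlib
import HarnessLib
import Summits.ResolutionOfSingularities.ResolutionOfSingularities.Theorems.HomologicalConductorSurfaceTerminationChartResolutionTower
import Summits.ResolutionOfSingularities.ResolutionOfSingularities.Theorems.HomologicalConductorSurfaceTerminationPrincipalizingResolution
import Summits.ResolutionOfSingularities.ResolutionOfSingularities.Theorems.HomologicalConductorSurfaceTerminationRationalPropagation
import Summits.ResolutionOfSingularities.ResolutionOfSingularities.Theorems.HomologicalConductorNoZenoThreadTower
import Summits.ResolutionOfSingularities.ResolutionOfSingularities.Theorems.SyzygyFlatteningHigherRankTerminationSingIdealLocAt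

/-!
# Route `HomologicalConductor`, kill test `SurfaceTermination` (stmt-ResolutionOfSingularities-16488):
# the chart dictionary of a resolution, part 5 — the package along the tower: a resolution of `T_(n+1)`
# yields a dominating resolution and a chart resolution whose localisation resolves `T_(n+2)`

OURS (cell res-hironaka, crux chain W4.4, seat res-L0-w44-stub-1; object U2a «chart dictionary» of
res-D-pv-045's programme `stub_pgNonincreasing`; res-L0-w44-plan-1 (ρ13a)); nothing here is a statement of
the manuscript under review (Hironaka 2017); AI-written, weaker than expert review.  SUPPORT-level, counted 0.

`exists_isResolution_towerSucc`: for the route binders, `tr.deg_k K = 2`, a SINGULAR stage `T = T_(n+1)` and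
ANY resolution `ξ : X ⟶ Spec T`, there are — modulo `CossartJannsenSaito2020General` — a resolution
`ρ : Z ⟶ Spec T` dominating `ξ` (`τ_X : Z ⟶ X` proper birational, `τ_X ≫ ξ = ρ`; part K1), an open `V ⊆ Z`, a
`k`-subalgebra `T ≤ N ≤ T_(n+2)` of `K` with `T_(n+2)` a LOCALISATION of `N` (for the inclusion algebra), and
a resolution `σ : V ⟶ Spec N` with `V.ι ≫ ρ = σ ≫ Spec (T → N)` (parts 2–4: `V = σ_B⁻¹(D₊(xt))`,
`N = nrm k[T ∪ ca·x⁻¹]`, `x` admissible), whose base change `V ×_N Spec T_(n+2) ⟶ Spec T_(n+2)` is a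
resolution of the next stage (part 3 `isResolution_pullback_snd_of_isLocalization`).  The lift
`σ_B : Z ⟶ Bl_I(Spec T)` (`I = cohomologyAnnihilator ↥T`), the admissible `x` and `V = σ_B⁻¹(D₊(xt))` are EXPOSED
(not hidden in an `∃ V`), so that a consumer can place `V` in the chart cover of the blowing up (res-D-pv-045's
`hasGeometricGenusLE_of_chart`: `gB := affineBlowup.π I`, `W a₀ := chartOpen x`).  This is the geometric
input of the Leray step of `stub_pgNonincreasing` in ONE statement; the Čech side then uses U2b
(`CechLocalization.isLocalizedModule_cechComapH1`) / stub-4's `length_cechH1_le_of_isLocalization` with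
`fX := σ`, `fY' := pullback.snd`, `g := pullback.fst`, `IsPullback.of_hasPullback`.  Also
`exists_finite_chartCover`: finitely many charts `D₊(ct)`, `c ∈ s ∋ x`, `I = (s)`, cover `Bl_I(Spec R)` — the raw
finite affine cover of the middle space through the chart of `x` (input of res-L0-w44-stub-4's GoodCover
`exists_affineCover_eq_and_disjoint`).  Def-free.

References: V. Cossart, U. Jannsen, S. Saito, LNM 2270 (2020), Thm. 1.2 [`CossartJannsenSaito2020`]; The Stacks
Project, Tags 0804, 01RN, 0307 [`StacksProject`]; A. Grothendieck, EGA IV₃ (1966) 8.10.5 [`EGAIV3`].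
-/

noncomputable section

-- single-problem summit: the doubled namespace component `ResolutionOfSingularities` is forced
set_option linter.dupNamespace false

namespace Summit.ResolutionOfSingularities.ResolutionOfSingularities.Theorems.SurfaceTermination.ChartResolution

open CategoryTheory CategoryTheory.Limits AlgebraicGeometry
open Literature.AlgebraicGeometry.Resolution
open Summit.ResolutionOfSingularities.ResolutionOfSingularities.Theorems.NoZeno.Birth
open Summit.ResolutionOfSingularities.ResolutionOfSingularities.Theorems.NoZeno.SandwichCluster

variable {k K : Type} [Field k] [Field K] [Algebra k K]

/-- **The chart package along the tower** (see the module docstring): from a resolution `ξ` of a singular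
stage `T_(n+1)`, a dominating resolution `ρ : Z ⟶ Spec T_(n+1)` (`τ_X ≫ ξ = ρ`), a model
`T_(n+1) ≤ N ≤ T_(n+2)` with `T_(n+2)` a localisation of `N`, a resolution `σ : V ⟶ Spec N` of `Spec N` on an
open `V ⊆ Z` lying over `Spec T_(n+1)`, and the resolution `V ×_N Spec T_(n+2) ⟶ Spec T_(n+2)` of the next
stage; modulo Cossart–Jannsen–Saito. [cite: CossartJannsenSaito2020, Thm. 1.2] [cite: StacksProject, Tag 0804]
[cite: EGAIV3, 8.10.5] -/
theorem exists_isResolution_towerSucc (hCJS : CossartJannsenSaito2020General.{0})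
    (O : ValuationSubring K) (A : Subalgebra k K) (hk : ∀ c : k, algebraMap k K c ∈ O) (hA : A.FG)
    (hfr : IsFractionRing ↥A K) (hAO : A.toSubring ≤ O.toSubring) (htr : Algebra.trdeg k K = 2) (n : ℕ)
    (hsing : ¬ IsRegularLocalRing ↥(tower O A (n + 1))) {X : Scheme.{0}}
    (ξ : X ⟶ Spec (.of ↥(tower O A (n + 1)))) (hξ : IsResolution ξ) :
    ∃ (Z : Scheme.{0}) (_ : IsIntegral Z) (ρ : Z ⟶ Spec (.of ↥(tower O A (n + 1)))) (τX : Z ⟶ X)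
      (σB : Z ⟶ affineBlowup (Literature.RingTheory.CohomologyAnnihilator.cohomologyAnnihilator ↥(tower O A (n + 1))))
      (x : ↥(tower O A (n + 1))) (hxI : x ∈ Literature.RingTheory.CohomologyAnnihilator.cohomologyAnnihilator ↥(tower O A (n + 1)))
      (hNT : (nrm (Algebra.adjoin k (((tower O A (n + 1)) : Set K) ∪
      {y : K | ∃ c : ↥(tower O A (n + 1)),
        c ∈ Literature.RingTheory.CohomologyAnnihilator.cohomologyAnnihilator ↥(tower O A (n + 1)) ∧
          y = (c : K) * (x : K)⁻¹}))) ≤ tower O A (n + 1 + 1))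
      (σ : ((σB ⁻¹ᵁ (affineBlowup.chartOpen x hxI).1 : Z.Opens) : Scheme.{0}) ⟶ Spec (.of ↥(nrm (Algebra.adjoin k (((tower O A (n + 1)) : Set K) ∪
      {y : K | ∃ c : ↥(tower O A (n + 1)),
        c ∈ Literature.RingTheory.CohomologyAnnihilator.cohomologyAnnihilator ↥(tower O A (n + 1)) ∧
          y = (c : K) * (x : K)⁻¹}))))),
      IsResolution ρ ∧ τX ≫ ξ = ρ ∧ IsProper τX ∧ IsBirational τX ∧
      σB ≫ affineBlowup.π _ = ρ ∧
      ((x : K) ∈ ca (tower O A (n + 1)) ∧ (x : K) ≠ 0 ∧ ∀ c ∈ ca (tower O A (n + 1)), c * (x : K)⁻¹ ∈ O) ∧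
      (σB ⁻¹ᵁ (affineBlowup.chartOpen x hxI).1).ι ≫ ρ =
        σ ≫ Spec.map (CommRingCat.ofHom (Subalgebra.inclusion (le_nrm_adjoin (tower O A (n + 1)))).toRingHom) ∧
      IsResolution σ ∧
      IsResolution (pullback.snd σ
        (Spec.map (CommRingCat.ofHom (Subalgebra.inclusion hNT).toRingHom))) ∧
      ∃ S : Submonoid ↥(nrm (Algebra.adjoin k (((tower O A (n + 1)) : Set K) ∪
      {y : K | ∃ c : ↥(tower O A (n + 1)),
        c ∈ Literature.RingTheory.CohomologyAnnihilator.cohomologyAnnihilator ↥(tower O A (n + 1)) ∧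
          y = (c : K) * (x : K)⁻¹}))), @IsLocalization _ _ S ↥(tower O A (n + 1 + 1)) _
        (Subalgebra.inclusion hNT).toRingHom.toAlgebra := by
  haveI := hfr
  -- the stage package
  obtain ⟨hnoeth, hic, hfrT, hloc, hdimT, hET⟩ := RationalDescent.stage_package_of_trdeg O A hk hA hfr hAO htr n hsing
  haveI := hnoeth; haveI := hic; haveI := hfrT; haveI := hloc
  have hTexc : IsExcellentRing ↥(tower O A (n + 1)) := (isExcellentRing_of_field k).of_essFiniteType hET
  have hTO : (tower O A (n + 1)).toSubring ≤ O.toSubring := (tn_tower_invariant O A hk hA hfr hAO (n + 1)).2.1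
  -- an admissible denominator `x ∈ ca T`, so `I = ca(↥T) ≠ 0`
  obtain ⟨x₀, hx₀, hx₀0, hadm⟩ := Thread.exists_admissible_tower O A hk hA hfr hAO (n + 1)
  let x : ↥(tower O A (n + 1)) := ⟨x₀, ca_subset _ hx₀⟩
  have hxI : x ∈ Literature.RingTheory.CohomologyAnnihilator.cohomologyAnnihilator ↥(tower O A (n + 1)) :=
    (tn_coe_mem_ca_iff _ x).mp hx₀
  have hx0 : (x : K) ≠ 0 := hx₀0
  have hI : Literature.RingTheory.CohomologyAnnihilator.cohomologyAnnihilator ↥(tower O A (n + 1)) ≠ ⊥ :=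
    fun h => hx₀0 (by have := hxI; rw [h, Ideal.mem_bot] at this; rw [show x₀ = (x : K) from rfl, this]; rfl)
  -- (K1) the dominating resolution on which `I · 𝒪` is invertible, and its lift to the blowing up
  obtain ⟨Z, hZ, ρ, τX, hρ, hτξ, hτp, hτb, hCart⟩ :=
    exists_isResolution_dominating_of_cjsGeneral hCJS hTexc hdimT.le _ hI ξ hξ
  haveI := hZ
  let σB := (affineBlowup.isBlowup _).lift ρ hCart
  have hσB : σB ≫ affineBlowup.π _ = ρ := IsBlowup.lift_comp _ _ _
  -- (K2) the chart resolution
  obtain ⟨e, he⟩ := exists_functionField_ringEquiv (tower O A (n + 1)) ρ hρ.isBirational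
  obtain ⟨hne, σ, -, hσc, hσres⟩ := exists_isResolution_chartMorphism (tower O A (n + 1)) ρ e he σB hσB hxI hρ hx0
  -- the next stage is the localisation of `N` at the centre
  have hsucc := tower_succ_eq_loc_nrm_adjoin O A (n + 1) hTO x hx₀ hx0 hadm
  have hNT : (nrm (Algebra.adjoin k (((tower O A (n + 1)) : Set K) ∪
      {y : K | ∃ c : ↥(tower O A (n + 1)),
        c ∈ Literature.RingTheory.CohomologyAnnihilator.cohomologyAnnihilator ↥(tower O A (n + 1)) ∧
          y = (c : K) * (x : K)⁻¹}))) ≤ tower O A (n + 1 + 1) := by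
    rw [hsucc]; exact SyzygyFlattening.self_le_locAt O _
  have hNO : (nrm (Algebra.adjoin k (((tower O A (n + 1)) : Set K) ∪
      {y : K | ∃ c : ↥(tower O A (n + 1)),
        c ∈ Literature.RingTheory.CohomologyAnnihilator.cohomologyAnnihilator ↥(tower O A (n + 1)) ∧
          y = (c : K) * (x : K)⁻¹}))).toSubring ≤ O.toSubring :=
    fun y hy => (tn_tower_invariant O A hk hA hfr hAO (n + 1 + 1)).2.1 (hNT hy)
  -- localisation, stated for any `T'` equal to `loc O N` (so that the stage itself can be substituted)
  have key : ∀ (T' : Subalgebra k K) (hT' : T' = SyzygyFlattening.locAt O (nrm (Algebra.adjoin k (((tower O A (n + 1)) : Set K) ∪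
      {y : K | ∃ c : ↥(tower O A (n + 1)),
        c ∈ Literature.RingTheory.CohomologyAnnihilator.cohomologyAnnihilator ↥(tower O A (n + 1)) ∧
          y = (c : K) * (x : K)⁻¹}))))
      (h : (nrm (Algebra.adjoin k (((tower O A (n + 1)) : Set K) ∪
      {y : K | ∃ c : ↥(tower O A (n + 1)),
        c ∈ Literature.RingTheory.CohomologyAnnihilator.cohomologyAnnihilator ↥(tower O A (n + 1)) ∧
          y = (c : K) * (x : K)⁻¹}))) ≤ T'),
      IsResolution (pullback.snd σ (Spec.map (CommRingCat.ofHom (Subalgebra.inclusion h).toRingHom))) ∧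
      ∃ S : Submonoid _, @IsLocalization _ _ S ↥T' _ (Subalgebra.inclusion h).toRingHom.toAlgebra := by
    intro T' hT' h
    subst hT'
    letI := (Subalgebra.inclusion h).toRingHom.toAlgebra
    have hL := SyzygyFlattening.isLocalization_locAt O (nrm (Algebra.adjoin k (((tower O A (n + 1)) : Set K) ∪
      {y : K | ∃ c : ↥(tower O A (n + 1)),
        c ∈ Literature.RingTheory.CohomologyAnnihilator.cohomologyAnnihilator ↥(tower O A (n + 1)) ∧
          y = (c : K) * (x : K)⁻¹}))) hNO
    haveI := hL
    exact ⟨isResolution_pullback_snd_of_isLocalization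
      ((IsUnit.submonoid ↥(SyzygyFlattening.locAt O (nrm (Algebra.adjoin k (((tower O A (n + 1)) : Set K) ∪
      {y : K | ∃ c : ↥(tower O A (n + 1)),
        c ∈ Literature.RingTheory.CohomologyAnnihilator.cohomologyAnnihilator ↥(tower O A (n + 1)) ∧
          y = (c : K) * (x : K)⁻¹}))))).comap
        (Subalgebra.inclusion (SyzygyFlattening.self_le_locAt O (nrm (Algebra.adjoin k (((tower O A (n + 1)) : Set K) ∪
      {y : K | ∃ c : ↥(tower O A (n + 1)),
        c ∈ Literature.RingTheory.CohomologyAnnihilator.cohomologyAnnihilator ↥(tower O A (n + 1)) ∧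
          y = (c : K) * (x : K)⁻¹})))))) σ hσres,
      _, hL⟩
  obtain ⟨hres', S, hS⟩ := key (tower O A (n + 1 + 1)) hsucc hNT
  exact ⟨Z, hZ, ρ, τX, σB, x, hxI, hNT, σ, hρ, hτξ, hτp, hτb, hσB, ⟨hx₀, hx0, hadm⟩, hσc, hσres, hres', S, hS⟩

/-! ## A finite chart cover of the blowing up through a given chart -/

/-- **Finitely many charts cover `Bl_I(Spec R)`** (`R` Noetherian), and the chart of a given `x ∈ I` may
be taken among them: with `I = (s)` for a finite `s ∋ x`, the `D₊(ct)`, `c ∈ s`, cover `Proj R[It]` (the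
irrelevant ideal is generated by the `bt`, `b ∈ I` — tree `irrelevant_le_span_reesT` — and `bt = Σ r_c · ct`).
For res-D-pv-045's `hasGeometricGenusLE_of_chart`: `α := ↥s`, `W c := (affineBlowup.chartOpen c.1 _).1`,
`a₀ := ⟨x, hx⟩` (then `W a₀` is the chart of `x` definitionally). [cite: StacksProject, Tag 0804] -/
theorem exists_finite_chartCover {R : Type} [CommRing R] [IsNoetherianRing R] (I : Ideal R) {x : R}
    (hxI : x ∈ I) :
    ∃ (s : Finset R) (hs : ∀ c ∈ s, c ∈ I) (_ : x ∈ s),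
      ⨆ c : ↥s, ((affineBlowup.chartOpen (I := I) c.1 (hs c.1 c.2)).1 : (affineBlowup I).Opens) = ⊤ := by
  classical
  obtain ⟨s₀, hs₀⟩ := (inferInstance : IsNoetherianRing R).noetherian I
  have hs : ∀ c ∈ insert x s₀, c ∈ I := by
    intro c hc
    rcases Finset.mem_insert.mp hc with rfl | hc
    · exact hxI
    · rw [← hs₀]; exact Submodule.subset_span hc
  refine ⟨insert x s₀, hs, Finset.mem_insert_self x s₀, ?_⟩
  -- the charts are the basic opens `D₊(ct)`
  have hW : ∀ c : ↥(insert x s₀), ((affineBlowup.chartOpen (I := I) c.1 (hs c.1 c.2)).1 :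
      (affineBlowup I).Opens) = Proj.basicOpen (reesGrading I) (reesT (I := I) c.1 (hs c.1 c.2)) :=
    fun c => affineBlowup.image_top_chartι c.1 (hs c.1 c.2)
  simp_rw [hW]
  refine Proj.iSup_basicOpen_eq_top (reesGrading I) _ ((irrelevant_le_span_reesT I).trans ?_)
  -- every `bt`, `b ∈ I = (s)`, is an `R`-combination of the `ct`, `c ∈ s`
  have hspan : Ideal.span (↑(insert x s₀) : Set R) = I := by
    rw [Finset.coe_insert, Ideal.span_insert]
    change Ideal.span {x} ⊔ Submodule.span R (↑s₀ : Set R) = I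
    rw [hs₀]
    exact sup_eq_right.mpr ((Ideal.span_singleton_le_iff_mem _).mpr hxI)
  have hmem : ∀ {b : R}, b ∈ Ideal.span (↑(insert x s₀) : Set R) → Polynomial.monomial 1 b ∈ reesAlgebra I :=
    fun hb => reesAlgebra.monomial_mem.mpr (by rw [pow_one, ← hspan]; exact hb)
  rw [Ideal.span_le]
  rintro _ ⟨⟨b, hb⟩, rfl⟩
  have hb' : b ∈ Ideal.span (↑(insert x s₀) : Set R) := by rw [hspan]; exact hb
  suffices h : ∀ b (hb : b ∈ Ideal.span (↑(insert x s₀) : Set R)) (hb'' : Polynomial.monomial 1 b ∈ reesAlgebra I),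
      (⟨Polynomial.monomial 1 b, hb''⟩ : reesAlgebra I) ∈
        Ideal.span (Set.range fun c : ↥(insert x s₀) => reesT (I := I) c.1 (hs c.1 c.2)) from
    h b hb' _
  intro b hb
  induction hb using Submodule.span_induction with
  | mem c hc => exact fun _ => Ideal.subset_span ⟨⟨c, hc⟩, rfl⟩
  | zero =>
    intro h0
    have : (⟨Polynomial.monomial 1 (0 : R), h0⟩ : reesAlgebra I) = 0 := Subtype.ext (by simp)
    rw [this]; exact Ideal.zero_mem _
  | add a b ha hb iha ihb =>
    intro hab
    have : (⟨Polynomial.monomial 1 (a + b), hab⟩ : reesAlgebra I) = ⟨_, hmem ha⟩ + ⟨_, hmem hb⟩ :=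
      Subtype.ext (by simp)
    rw [this]
    exact Ideal.add_mem _ (iha _) (ihb _)
  | smul r a ha iha =>
    intro hra
    have : (⟨Polynomial.monomial 1 (r • a), hra⟩ : reesAlgebra I) =
        (⟨Polynomial.C r, (reesAlgebra I).algebraMap_mem r⟩ : reesAlgebra I) * ⟨_, hmem ha⟩ :=
      Subtype.ext (by simp [Polynomial.C_mul_monomial, smul_eq_mul])
    rw [this]
    exact Ideal.mul_mem_left _ _ (iha _)

end Summit.ResolutionOfSingularities.ResolutionOfSingularities.Theorems.SurfaceTermination.ChartResolution

end
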